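/-
Copyright: pub-rosobs cell (Resolution Observatory), carver gen 49.  Companion file; statements OURS — the remaining IDENTITY-LEVEL
inputs of BOOTSTRAP step (2) (engine 1 gen 33, THEOREM-LC §6): LEMMA Γ (a) (the pure part of `Γ_σ(ε_a) − ε_a` is twice that
of `Φ(ε_a) − ε_a` to cubic order) and the `u := σ²` re-parametrisation of a `σ ↦ −σ`-symmetric isotropy.  Instrument — NOT a
resolution theorem, NOT a statement about the invariant of [AbramovichTemkinWlodarczyk2024], NOT summit progress.
-/
import Literature.AlgebraicGeometry.Resolution.WeightedCentreIsotropyTwist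
import Mathlib.Algebra.Polynomial.Expand
import Mathlib.Algebra.Polynomial.Div
import HarnessLib

/-!
# Even isotropies: LEMMA Γ (a) and the `u := σ²` re-parametrisation

Setting as in `WeightedCentreIsotropyTwist`: `A₀` a commutative ring (cell: `A₀ = k[ε_N]`), `A₀[X]` with `X = σ`,
`τ = sigmaNeg`, `Φ_{−σ} = twistConj Φ`, `Γ_σ = gammaOf Φ = Φ ∘ Φ_{−σ}`.  "Pure parts" are read through an arbitrary ring map
`π : A₀ →+* k₀` (cell: the augmentation `k[ε_N] → k`, `ε ↦ 0`), extended coefficientwise to `Polynomial.map π : A₀[X] → k₀[X]`.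

* `coeff_sigmaNeg` : `(τ f)ₙ = (−1)ⁿ fₙ`; `IsSigmaEven f` (odd coefficients vanish) with `IsSigmaEven.sigmaNeg_eq`,
  `isSigmaEven_of_sigmaNeg_eq` (needs `2` regular), `IsSigmaEven.expand_contract` (`f = g(σ²)` with `g = contract 2 f`).
* `sigmaNeg_apply_comm` : `twistConj Γ = Γ` (i.e. `Γ_{−σ} = Γ_σ`) iff-direction `τ ∘ Γ = Γ ∘ τ`; then `Γ` preserves even polynomials
  and `evenContract Γ` — `g ↦ contract 2 (Γ (g(σ²)))` — is a RING endomorphism of `A₀[u]` (`u ↦ σ²`) with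
  `expand 2 ∘ evenContract Γ = Γ ∘ expand 2` (`expand_evenContract`), `evenContract Γ u = u`, and `Γ ≡ id (mod σ^{2n})` on constants
  ⇒ `evenContract Γ ≡ id (mod uⁿ)` (`evenContract_C_sub_C_mem`).
* **LEMMA Γ (a)** (`map_gammaOf_C_sub_C_sub_two_mul_mem`): if `Φ X = X`, `Φ ≡ id (mod σ)` on constants and all pure parts
  `π̄(Φ(C a) − C a)` lie in `(σ²)`, then `π̄(Γ_σ(C a) − C a) ≡ 2·π̄(Φ(C a) − C a) (mod σ³)`; so a pure `cσ²` in slot `a` becomes a pure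
  `2cσ²` (`map_gammaOf_C_sub_C_sub_C_two_mul_mem`).
* `evenContract_pure_shift` : for `Γ` even with pure part `≡ 2cσ² (mod σ³)` in slot `a`, the re-parametrised `Γ̃ = evenContract Γ` has pure
  part `≡ 2c·u (mod u²)` in slot `a` — an order-ONE pure shift (in the cell this contradicts ND0 when `2c ≠ 0`, i.e. `p` odd; ND0, the
  gradings and PURE(ρ) are NOT typed here).

Pattern cite [cite: SerreLocalFields1979, Ch. II §4 Lemma 1] (filtration bookkeeping for operators `≡ 1` modulo powers of an ideal);
formalisation and statements ours, elementary.
-/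

namespace Literature.AlgebraicGeometry.Resolution.WeightedBlowup

open Polynomial

variable {A₀ : Type*} [CommRing A₀] {k₀ : Type*} [CommRing k₀]

/-! ## Coefficients of `τ f` and even polynomials -/

/-- `(τ f)ₙ = (−1)ⁿ · fₙ` (plumbing). [cite: SerreLocalFields1979, Ch. II §4 Lemma 1] -/
theorem coeff_sigmaNeg (f : A₀[X]) (n : ℕ) : (sigmaNeg f).coeff n = (-1) ^ n * f.coeff n := by
  induction f using Polynomial.induction_on' with
  | add f g hf hg => simp only [map_add, coeff_add, hf, hg, mul_add]
  | monomial m a =>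
    rw [sigmaNeg_apply, aeval_monomial, algebraMap_eq, neg_pow, show (-1 : A₀[X]) = C (-1) by simp, ← C_pow,
      ← mul_assoc, ← C_mul, coeff_C_mul, coeff_X_pow, coeff_monomial]
    by_cases h : n = m
    · subst h; simp [mul_comm]
    · simp [h, Ne.symm h]

/-- `f` is EVEN in `σ`: all odd-degree coefficients vanish (ours). [cite: SerreLocalFields1979, Ch. II §4 Lemma 1] -/
def IsSigmaEven (f : A₀[X]) : Prop := ∀ n, Odd n → f.coeff n = 0

/-- An even polynomial is `τ`-invariant (plumbing). [cite: SerreLocalFields1979, Ch. II §4 Lemma 1] -/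
theorem IsSigmaEven.sigmaNeg_eq {f : A₀[X]} (hf : IsSigmaEven f) : sigmaNeg f = f := by
  ext n
  rw [coeff_sigmaNeg]
  rcases Nat.even_or_odd n with hn | hn
  · rw [hn.neg_one_pow, one_mul]
  · rw [hf n hn, mul_zero]

/-- A `τ`-invariant polynomial is even, provided `2` is regular in `A₀` (cell: `p` odd) (plumbing; `h2` is load-bearing:
over `𝔽₂` every polynomial is `τ`-invariant). [cite: SerreLocalFields1979, Ch. II §4 Lemma 1] -/
theorem isSigmaEven_of_sigmaNeg_eq (h2 : ∀ c : A₀, 2 * c = 0 → c = 0) {f : A₀[X]} (hf : sigmaNeg f = f) : IsSigmaEven f := by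
  intro n hn
  have h := congrArg (fun g : A₀[X] => g.coeff n) hf
  simp only [coeff_sigmaNeg, hn.neg_one_pow, neg_one_mul] at h
  -- h : -f.coeff n = f.coeff n
  apply h2
  rw [two_mul]
  nth_rewrite 1 [← h]
  exact neg_add_cancel _

/-- If `2` is a unit of `A₀` then `2` is regular (plumbing). [cite: SerreLocalFields1979, Ch. II §4 Lemma 1] -/
theorem two_mul_eq_zero_imp (h : IsUnit (2 : A₀)) (c : A₀) (hc : 2 * c = 0) : c = 0 := by
  obtain ⟨u, hu⟩ := h
  have : (↑u⁻¹ : A₀) * (2 * c) = 0 := by rw [hc, mul_zero]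
  rwa [← mul_assoc, ← hu, Units.inv_mul, one_mul] at this

/-- Evenness passes to pure parts (plumbing). [cite: SerreLocalFields1979, Ch. II §4 Lemma 1] -/
theorem IsSigmaEven.map {f : A₀[X]} (hf : IsSigmaEven f) (π : A₀ →+* k₀) : IsSigmaEven (f.map π) :=
  fun n hn => by rw [coeff_map, hf n hn, map_zero]

/-- `g(σ²)` is even (plumbing). [cite: SerreLocalFields1979, Ch. II §4 Lemma 1] -/
theorem isSigmaEven_expand_two (g : A₀[X]) : IsSigmaEven (expand A₀ 2 g) := by
  intro n hn
  rw [coeff_expand two_pos, if_neg]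
  exact fun h => (Nat.not_even_iff_odd.mpr hn) (even_iff_two_dvd.mpr h)

/-- `expand ∘ contract = id` on polynomials whose coefficients off the multiples of `p` vanish (a coefficient form of Mathlib's
`expand_contract`, ours). [cite: SerreLocalFields1979, Ch. II §4 Lemma 1] -/
theorem expand_contract_of_coeff {p : ℕ} (hp : p ≠ 0) {f : A₀[X]} (hf : ∀ n, ¬ p ∣ n → f.coeff n = 0) :
    expand A₀ p (contract p f) = f := by
  ext n
  rw [coeff_expand (Nat.pos_of_ne_zero hp), coeff_contract hp]
  split_ifs with h
  · rw [Nat.div_mul_cancel h]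
  · exact (hf n h).symm

/-- An even polynomial is `g(σ²)` with `g = contract 2 f` (plumbing). [cite: SerreLocalFields1979, Ch. II §4 Lemma 1] -/
theorem IsSigmaEven.expand_contract {f : A₀[X]} (hf : IsSigmaEven f) : expand A₀ 2 (contract 2 f) = f :=
  expand_contract_of_coeff two_ne_zero fun n hn =>
    hf n (Nat.not_even_iff_odd.mp fun he => hn (even_iff_two_dvd.mp he))

/-- `contract` is compatible with subtraction (plumbing). [cite: SerreLocalFields1979, Ch. II §4 Lemma 1] -/
theorem contract_sub {p : ℕ} (hp : p ≠ 0) (f g : A₀[X]) : contract p (f - g) = contract p f - contract p g := by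
  ext n; simp only [coeff_contract hp, coeff_sub]

/-- `τ` commutes with taking pure parts (plumbing). [cite: SerreLocalFields1979, Ch. II §4 Lemma 1] -/
theorem map_sigmaNeg (π : A₀ →+* k₀) (f : A₀[X]) : (sigmaNeg f).map π = sigmaNeg (f.map π) := by
  have h : (mapRingHom π).comp (sigmaNeg (A₀ := A₀)).toRingHom
      = (sigmaNeg (A₀ := k₀)).toRingHom.comp (mapRingHom π) := by
    refine Polynomial.ringHom_ext (fun a => ?_) ?_
    · simp [sigmaNeg_C]
    · simp [sigmaNeg_X]
  exact congrArg (fun Ψ : A₀[X] →+* k₀[X] => Ψ f) h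

/-- Membership in `(σⁿ)` passes to pure parts (plumbing). [cite: SerreLocalFields1979, Ch. II §4 Lemma 1] -/
theorem map_mem_span_X_pow (π : A₀ →+* k₀) {f : A₀[X]} {n : ℕ} (h : f ∈ Ideal.span {(X : A₀[X]) ^ n}) :
    f.map π ∈ Ideal.span {(X : k₀[X]) ^ n} := by
  obtain ⟨g, rfl⟩ := Ideal.mem_span_singleton'.mp h
  rw [Polynomial.map_mul, Polynomial.map_pow, map_X]
  exact Ideal.mem_span_singleton'.mpr ⟨g.map π, rfl⟩

/-! ## `τ`-commuting endomorphisms and the `u := σ²` re-parametrisation -/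

/-- `Γ_{−σ} = Γ_σ` means `τ ∘ Γ = Γ ∘ τ` (plumbing). [cite: SerreLocalFields1979, Ch. II §4 Lemma 1] -/
theorem sigmaNeg_apply_comm {Γ : A₀[X] →+* A₀[X]} (h : twistConj Γ = Γ) (f : A₀[X]) :
    sigmaNeg (Γ f) = Γ (sigmaNeg f) := by
  have := congrArg (fun Ψ : A₀[X] →+* A₀[X] => Ψ (sigmaNeg f)) h
  simpa only [twistConj_apply, sigmaNeg_sigmaNeg] using this

/-- A `τ`-commuting endomorphism preserves even polynomials (`2` regular) (derived here).
[cite: SerreLocalFields1979, Ch. II §4 Lemma 1] -/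
theorem IsSigmaEven.apply {Γ : A₀[X] →+* A₀[X]} (h : twistConj Γ = Γ) (h2 : ∀ c : A₀, 2 * c = 0 → c = 0) {f : A₀[X]}
    (hf : IsSigmaEven f) : IsSigmaEven (Γ f) :=
  isSigmaEven_of_sigmaNeg_eq h2 (by rw [sigmaNeg_apply_comm h, hf.sigmaNeg_eq])

/-- Key identity behind the re-parametrisation: `Γ (g(σ²)) = (contract 2 (Γ (g(σ²))))(σ²)` (derived here).
[cite: SerreLocalFields1979, Ch. II §4 Lemma 1] -/
theorem expand_contract_apply_expand {Γ : A₀[X] →+* A₀[X]} (h : twistConj Γ = Γ) (h2 : ∀ c : A₀, 2 * c = 0 → c = 0)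
    (g : A₀[X]) : expand A₀ 2 (contract 2 (Γ (expand A₀ 2 g))) = Γ (expand A₀ 2 g) :=
  ((isSigmaEven_expand_two g).apply h h2).expand_contract

/-- **The `u := σ²` re-parametrisation** `Γ̃` of a `τ`-commuting endomorphism `Γ` (`2` regular): `Γ̃ g := contract 2 (Γ (g(σ²)))`, a RING
endomorphism of `A₀[u]` (written `A₀[X]` again, `X = u`) (construction ours). [cite: SerreLocalFields1979, Ch. II §4 Lemma 1] -/
noncomputable def evenContract (Γ : A₀[X] →+* A₀[X]) (h : twistConj Γ = Γ) (h2 : ∀ c : A₀, 2 * c = 0 → c = 0) :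
    A₀[X] →+* A₀[X] where
  toFun g := contract 2 (Γ (expand A₀ 2 g))
  map_one' := by rw [map_one, map_one, ← C_1, contract_C]
  map_mul' g₁ g₂ := by
    have he := expand_contract_apply_expand h h2 g₂
    set c₂ := contract 2 (Γ (expand A₀ 2 g₂))
    rw [map_mul, map_mul, ← he, contract_mul_expand two_ne_zero]
  map_zero' := by rw [map_zero, map_zero, ← C_0, contract_C]
  map_add' g₁ g₂ := by simp only [map_add, contract_add two_ne_zero]

/-- Unfolding (plumbing). [cite: SerreLocalFields1979, Ch. II §4 Lemma 1] -/
theorem evenContract_apply (Γ : A₀[X] →+* A₀[X]) (h : twistConj Γ = Γ) (h2 : ∀ c : A₀, 2 * c = 0 → c = 0) (g : A₀[X]) :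
    evenContract Γ h h2 g = contract 2 (Γ (expand A₀ 2 g)) := rfl

/-- `Γ̃` re-parametrises `Γ`: `(Γ̃ g)(σ²) = Γ (g(σ²))` (derived here). [cite: SerreLocalFields1979, Ch. II §4 Lemma 1] -/
theorem expand_evenContract (Γ : A₀[X] →+* A₀[X]) (h : twistConj Γ = Γ) (h2 : ∀ c : A₀, 2 * c = 0 → c = 0) (g : A₀[X]) :
    expand A₀ 2 (evenContract Γ h h2 g) = Γ (expand A₀ 2 g) :=
  expand_contract_apply_expand h h2 g

/-- `Γ̃ u = u` when `Γ σ = σ` (plumbing). [cite: SerreLocalFields1979, Ch. II §4 Lemma 1] -/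
theorem evenContract_X (Γ : A₀[X] →+* A₀[X]) (h : twistConj Γ = Γ) (h2 : ∀ c : A₀, 2 * c = 0 → c = 0) (hX : Γ X = X) :
    evenContract Γ h h2 X = X := by
  rw [evenContract_apply, expand_X, map_pow, hX, ← expand_X, contract_expand 2 two_ne_zero]

/-- `Γ̃` on constants (plumbing). [cite: SerreLocalFields1979, Ch. II §4 Lemma 1] -/
theorem evenContract_C (Γ : A₀[X] →+* A₀[X]) (h : twistConj Γ = Γ) (h2 : ∀ c : A₀, 2 * c = 0 → c = 0) (a : A₀) :
    evenContract Γ h h2 (C a) = contract 2 (Γ (C a)) := by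
  rw [evenContract_apply, expand_C]

/-- Orders HALVE under the re-parametrisation: `Γ(C a) ≡ C a (mod σ^{2n})` ⇒ `Γ̃(C a) ≡ C a (mod uⁿ)` (derived here; with `n = 1`: an isotropy
`≡ id (mod σ²)` — e.g. `Γ_σ`, LEMMA Γ (b) — becomes `≡ id (mod u)`). [cite: SerreLocalFields1979, Ch. II §4 Lemma 1] -/
theorem evenContract_C_sub_C_mem (Γ : A₀[X] →+* A₀[X]) (h : twistConj Γ = Γ) (h2 : ∀ c : A₀, 2 * c = 0 → c = 0) {n : ℕ} {a : A₀}
    (hΓ : Γ (C a) - C a ∈ Ideal.span {(X : A₀[X]) ^ (2 * n)}) :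
    evenContract Γ h h2 (C a) - C a ∈ Ideal.span {(X : A₀[X]) ^ n} := by
  obtain ⟨m, hm⟩ := Ideal.mem_span_singleton'.mp hΓ
  have hΓa : Γ (C a) = C a + m * expand A₀ 2 (X ^ n) := by
    rw [map_pow, expand_X, ← pow_mul, hm]; ring
  rw [evenContract_C, hΓa, contract_add two_ne_zero, contract_C, contract_mul_expand two_ne_zero]
  exact Ideal.mem_span_singleton'.mpr ⟨contract 2 m, by ring⟩

/-- Pure parts of `Γ̃`: `π̄ (Γ̃ (C a)) = contract 2 (π̄ (Γ (C a)))` (plumbing). [cite: SerreLocalFields1979, Ch. II §4 Lemma 1] -/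
theorem map_evenContract_C (π : A₀ →+* k₀) (Γ : A₀[X] →+* A₀[X]) (h : twistConj Γ = Γ) (h2 : ∀ c : A₀, 2 * c = 0 → c = 0)
    (a : A₀) : (evenContract Γ h h2 (C a)).map π = contract 2 ((Γ (C a)).map π) := by
  rw [evenContract_C, map_contract two_ne_zero]

/-! ## LEMMA Γ (a): pure parts double under `Φ ↦ Γ_σ` -/

/-- If `Φ σ = σ` and all pure parts `π̄(Φ(C a) − C a)` lie in `(σ²)`, then `π̄ ∘ Φ ≡ π̄ (mod σ²)` on all of `A₀[σ]` (derived here).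
[cite: SerreLocalFields1979, Ch. II §4 Lemma 1] -/
theorem map_apply_sub_map_mem_sq (π : A₀ →+* k₀) {Φ : A₀[X] →+* A₀[X]} (hX : Φ X = X)
    (hP : ∀ a, (Φ (C a) - C a).map π ∈ Ideal.span {(X : k₀[X]) ^ 2}) (g : A₀[X]) :
    (Φ g).map π - g.map π ∈ Ideal.span {(X : k₀[X]) ^ 2} := by
  have h := sub_mem_of_forall_C (Γ := (mapRingHom π).comp Φ) (Γ' := mapRingHom π) (Ideal.span {(X : k₀[X]) ^ 2})
    (by simp [hX]) (fun a => by simpa [Polynomial.map_sub] using hP a) g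
  simpa using h

/-- … and `π̄ ∘ Φ ≡ π̄ (mod σ³)` on the ideal `(σ)` (derived here). [cite: SerreLocalFields1979, Ch. II §4 Lemma 1] -/
theorem map_apply_sub_map_mem_cube (π : A₀ →+* k₀) {Φ : A₀[X] →+* A₀[X]} (hX : Φ X = X)
    (hP : ∀ a, (Φ (C a) - C a).map π ∈ Ideal.span {(X : k₀[X]) ^ 2}) {f : A₀[X]} (hf : f ∈ Ideal.span {(X : A₀[X])}) :
    (Φ f).map π - f.map π ∈ Ideal.span {(X : k₀[X]) ^ 3} := by
  obtain ⟨g, rfl⟩ := Ideal.mem_span_singleton'.mp hf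
  obtain ⟨m, hm⟩ := Ideal.mem_span_singleton'.mp (map_apply_sub_map_mem_sq π hX hP g)
  rw [map_mul, hX, Polynomial.map_mul, Polynomial.map_mul, map_X, ← sub_mul, ← hm]
  exact Ideal.mem_span_singleton'.mpr ⟨m, by ring⟩

/-- **LEMMA Γ (a)** (identity level): for `Φ σ = σ`, `Φ ≡ id (mod σ)` on constants and pure parts in `(σ²)`:
`π̄(Γ_σ(C a) − C a) ≡ 2 · π̄(Φ(C a) − C a) (mod σ³)` (derived here). [cite: SerreLocalFields1979, Ch. II §4 Lemma 1] -/
theorem map_gammaOf_C_sub_C_sub_two_mul_mem (π : A₀ →+* k₀) {Φ : A₀[X] →+* A₀[X]} (hX : Φ X = X)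
    (hΦ : ∀ a, Φ (C a) - C a ∈ Ideal.span {(X : A₀[X])})
    (hP : ∀ a, (Φ (C a) - C a).map π ∈ Ideal.span {(X : k₀[X]) ^ 2}) (a : A₀) :
    (gammaOf Φ (C a) - C a).map π - 2 * (Φ (C a) - C a).map π ∈ Ideal.span {(X : k₀[X]) ^ 3} := by
  set D := Φ (C a) - C a with hD
  have hΓ : gammaOf Φ (C a) - C a = D + Φ (sigmaNeg D) := by
    rw [gammaOf_apply, twistConj_C]
    simp only [hD, map_sub, sigmaNeg_C]
    ring
  have hsplit : (D + Φ (sigmaNeg D)).map π - 2 * D.map π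
      = ((Φ (sigmaNeg D)).map π - (sigmaNeg D).map π) + ((sigmaNeg D).map π - D.map π) := by
    rw [Polynomial.map_add]; ring
  rw [hΓ, hsplit]
  refine add_mem (map_apply_sub_map_mem_cube π hX hP ?_) ?_
  · simpa using sigmaNeg_mem_span_X_pow (n := 1) (by simpa using hΦ a)
  · -- `π̄ D = X² h`, and `τ(X² h) − X² h = X² (τ h − h) ∈ (X³)`
    obtain ⟨m, hm⟩ := Ideal.mem_span_singleton'.mp (hP a)
    obtain ⟨r, hr⟩ := Ideal.mem_span_singleton'.mp (sigmaNeg_sub_self_mem m)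
    rw [map_sigmaNeg, ← hm, map_mul, map_pow, sigmaNeg_X, neg_pow_two, ← sub_mul, ← hr]
    exact Ideal.mem_span_singleton'.mpr ⟨r, by ring⟩

/-- LEMMA Γ (a) with an explicit pure coefficient: a pure `cσ²` in slot `a` of `Φ` gives a pure `2cσ²` in slot `a` of `Γ_σ`, to cubic order
(derived here). [cite: SerreLocalFields1979, Ch. II §4 Lemma 1] -/
theorem map_gammaOf_C_sub_C_sub_C_two_mul_mem (π : A₀ →+* k₀) {Φ : A₀[X] →+* A₀[X]} (hX : Φ X = X)
    (hΦ : ∀ a, Φ (C a) - C a ∈ Ideal.span {(X : A₀[X])})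
    (hP : ∀ a, (Φ (C a) - C a).map π ∈ Ideal.span {(X : k₀[X]) ^ 2}) {a : A₀} {c : k₀}
    (hc : (Φ (C a) - C a).map π - C c * X ^ 2 ∈ Ideal.span {(X : k₀[X]) ^ 3}) :
    (gammaOf Φ (C a) - C a).map π - C (2 * c) * X ^ 2 ∈ Ideal.span {(X : k₀[X]) ^ 3} := by
  have h := add_mem (map_gammaOf_C_sub_C_sub_two_mul_mem π hX hΦ hP a) (Ideal.mul_mem_left _ 2 hc)
  have h2C : (C (2 * c) : k₀[X]) = 2 * C c := by rw [C_mul, map_ofNat]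
  rw [h2C]
  convert h using 1
  ring

/-- The hypotheses propagate: `Γ_σ` again has pure parts in `(σ²)` (indeed `Γ_σ ≡ id (mod σ²)`, LEMMA Γ (b)) (plumbing).
[cite: SerreLocalFields1979, Ch. II §4 Lemma 1] -/
theorem map_gammaOf_C_sub_C_mem_sq (π : A₀ →+* k₀) {Φ : A₀[X] →+* A₀[X]} (hX : Φ X = X)
    (hΦ : ∀ a, Φ (C a) - C a ∈ Ideal.span {(X : A₀[X])}) (a : A₀) :
    (gammaOf Φ (C a) - C a).map π ∈ Ideal.span {(X : k₀[X]) ^ 2} :=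
  map_mem_span_X_pow π (gammaOf_sub_self_mem hX hΦ (C a))

/-! ## The order-one pure shift of the re-parametrised even isotropy -/

/-- Reading a pure `c'σ²` to cubic order through `contract 2`: `contract 2 e ≡ c'·u (mod u²)` (plumbing).
[cite: SerreLocalFields1979, Ch. II §4 Lemma 1] -/
theorem contract_sub_C_mul_X_mem {e : k₀[X]} {c' : k₀} (h : e - C c' * X ^ 2 ∈ Ideal.span {(X : k₀[X]) ^ 3}) :
    contract 2 e - C c' * X ∈ Ideal.span {(X : k₀[X]) ^ 2} := by
  rw [Ideal.mem_span_singleton, X_pow_dvd_iff] at h ⊢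
  have h0 := h 0 (by norm_num)
  have h2 := h 2 (by norm_num)
  simp only [coeff_sub, coeff_C_mul, coeff_X_pow] at h0 h2
  norm_num at h0 h2
  intro d hd
  interval_cases d
  · simpa [coeff_contract, coeff_C_mul] using h0
  · simpa [coeff_contract, coeff_C_mul, coeff_X_one] using h2

/-- **BOOTSTRAP (2), the `u := σ²` system at identity level** (derived here).  Let `Γ` be an endomorphism of `A₀[σ]` with `Γ σ = σ`,
`Γ_{−σ} = Γ` (`twistConj Γ = Γ`), `2` regular in `A₀`, `Γ ≡ id (mod σ²)` on constants, and with pure part `≡ c'σ² (mod σ³)` in slot `a`.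
Then `Γ̃ := evenContract Γ` satisfies `Γ̃ u = u`, `Γ̃ ≡ id (mod u)` on constants, and its pure part in slot `a` is `≡ c'·u (mod u²)` —
an order-ONE pure term.  (Cell: `Γ = Γ_σ`, `c' = 2c ≠ 0` for `p` odd by LEMMA Γ (a); `Γ_{−σ} = Γ_σ` by LEMMA Γ (c) + O_ρ; the order-one
pure term then contradicts ND0 — not typed here.) [cite: SerreLocalFields1979, Ch. II §4 Lemma 1] -/
theorem evenContract_pure_shift (π : A₀ →+* k₀) (Γ : A₀[X] →+* A₀[X]) (h : twistConj Γ = Γ)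
    (h2 : ∀ c : A₀, 2 * c = 0 → c = 0) (hX : Γ X = X) (hΓ : ∀ b, Γ (C b) - C b ∈ Ideal.span {(X : A₀[X]) ^ 2})
    {a : A₀} {c' : k₀} (hc : (Γ (C a) - C a).map π - C c' * X ^ 2 ∈ Ideal.span {(X : k₀[X]) ^ 3}) :
    evenContract Γ h h2 X = X ∧ (∀ b, evenContract Γ h h2 (C b) - C b ∈ Ideal.span {(X : A₀[X])}) ∧
      (evenContract Γ h h2 (C a) - C a).map π - C c' * X ∈ Ideal.span {(X : k₀[X]) ^ 2} := by
  refine ⟨evenContract_X Γ h h2 hX, fun b => ?_, ?_⟩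
  · simpa using evenContract_C_sub_C_mem Γ h h2 (n := 1) (by simpa using hΓ b)
  · have hmap : (evenContract Γ h h2 (C a) - C a).map π = contract 2 ((Γ (C a) - C a).map π) := by
      rw [Polynomial.map_sub, map_evenContract_C, Polynomial.map_sub, map_C, contract_sub two_ne_zero, contract_C]
    rw [hmap]
    exact contract_sub_C_mul_X_mem hc

/-- The same for `Γ := Γ_σ = gammaOf Φ` with the pure coefficient computed by LEMMA Γ (a): pure `cσ²` in slot `a` of `Φ` ⇒ order-one pure
term `2c·u` of `Γ̃_σ` in slot `a` (derived here; hypotheses: `Φ σ = σ`, `Φ ≡ id (mod σ)` on constants, pure parts of `Φ` in `(σ²)`,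
`Γ_{−σ} = Γ_σ`, `2` regular). [cite: SerreLocalFields1979, Ch. II §4 Lemma 1] -/
theorem evenContract_gammaOf_pure_shift (π : A₀ →+* k₀) {Φ : A₀[X] →+* A₀[X]} (hX : Φ X = X)
    (hΦ : ∀ a, Φ (C a) - C a ∈ Ideal.span {(X : A₀[X])})
    (hP : ∀ a, (Φ (C a) - C a).map π ∈ Ideal.span {(X : k₀[X]) ^ 2})
    (h : twistConj (gammaOf Φ) = gammaOf Φ) (h2 : ∀ c : A₀, 2 * c = 0 → c = 0)
    {a : A₀} {c : k₀} (hc : (Φ (C a) - C a).map π - C c * X ^ 2 ∈ Ideal.span {(X : k₀[X]) ^ 3}) :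
    evenContract (gammaOf Φ) h h2 X = X ∧
      (∀ b, evenContract (gammaOf Φ) h h2 (C b) - C b ∈ Ideal.span {(X : A₀[X])}) ∧
      (evenContract (gammaOf Φ) h h2 (C a) - C a).map π - C (2 * c) * X ∈ Ideal.span {(X : k₀[X]) ^ 2} :=
  evenContract_pure_shift π (gammaOf Φ) h h2 (gammaOf_X hX) (fun b => gammaOf_sub_self_mem hX hΦ (C b))
    (map_gammaOf_C_sub_C_sub_C_two_mul_mem π hX hΦ hP hc)

end Literature.AlgebraicGeometry.Resolution.WeightedBlowup
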